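import Summits.BirchSwinnertonDyer.BirchSwinnertonDyer.Theorems.PrintCFramBottomClassIndexLawFiveLeSelmerCountLowerBoundPRankLevelZero
import Summits.BirchSwinnertonDyer.BirchSwinnertonDyer.Theorems.PrintCFramBottomClassIndexLawFiveLeSelmerCountKummerSupplyAssembly
import Summits.BirchSwinnertonDyer.Rank1Residual.X11b.LocalPrimaryCohomologyEP
import HarnessLib

/-!
# Route `PrintCFram`, crux C2 `BottomClassIndexLawFiveLe` (stmt-BirchSwinnertonDyer-20372), line
# `eisenstein-resource-bdp-line` (registry v23/v24, stubs B1-level / B1-sha): **THE B1-sha FIRST-ORDER CENSUS IS UNCONDITIONAL** —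
# the named fact `localEulerPoincareCharacteristic ℚ_v` (Milne *ADT* I Thm. 2.8), carried as the binder `hEP` by every
# (LA) / LEVEL-0 theorem of the census (w2 g10 p681387/p681509, w2 g11 p684559/p685187/p685598/p687909, this seat p688925/p689980 and
# `…LowerBoundPRankLevelZero`), is a TREE THEOREM: `Rank1Residual.X11b.LocBridge.localEulerPoincareCharacteristic_adicCompletionEP`
# (Tate's local Euler–Poincaré characteristic for all finite modules, `Rank1Residual.GaloisImage.EPCTate`, cell b2b-bsdres team n1011);
# this file DISCHARGES `hEP` in the headline statements
# (cell `bsd-print-cfram`, width seat `bsd-line-cfram-p1-w7` g5; helper `--supports` 20372; 0 defs, 0 facts, 0 sorry; UNCONDITIONAL)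

HONEST FRAMING. Nothing about BSD is proved here; no summit statement is proved by this seat; no stub of the registered skeleton is
closed. Every theorem below is a ONE-LINE corollary «landed census theorem ∘ `localEulerPoincareCharacteristic_adicCompletionEP ℚ v`»
(naming: suffix `EP`, as in `Rank1Residual.X11b.LocalPrimaryCohomologyEP`). Net effect for the dossier: the sentences «mod Milne I 2.8»
/ «granted the local Euler characteristic» in the B1-sha census (HANDOFF §w2 g10 / §w2 g11 / §w4 g10 / §w7 g4 / §w7 g5) can be dropped —
what remains conditional in the census is only Cassels–Tate + GZK on the «Ш[p] = 0 ⟹ BSD_p-reading» side (w4 g10 p683684), nothing on the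
«Ш[p] ≠ 0» side.

* §0 **`natCard_galoisCohomology_one_eq_primeEP`** — w2 g10's local count `#H¹(ℚ_v, A) = p` (p681387), `hEP` discharged.
* §1 **`coaligned_of_forall_exists_adaptedRootEP`** — w2 g10's (LA) ⟹ CO-ALIGNED, `hEP` discharged.
* §2 (LA) branch: **`natCard_h1Unramified_le_natCard_selmerGroup_of_forall_exists_adaptedRoot_of_cmRamifiedEP`** (`#R_rel(Φ) ≤ #Sel_p`),
  **`exists_sha_ne_zero_of_forall_exists_adaptedRoot_of_classGroupChiCard_ne_one_of_cmRamifiedEP`** (w2 g11 p685598 §3: EVEN-IRREGULAR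
  ∧ (LA) ⟹ `Ш(W)[p] ≠ 0`), **`pow_succ_le_natCard_selmerGroup_of_forall_exists_adaptedRoot_of_pow_le_evenChiTorsion_of_cmRamifiedEP`**
  (this seat p689980: `p^{r+1} ≤ #Sel_p`, `p^r ≤ #Ш[p]`).
* §3 LEVEL-0 branch: **`natCard_h1Unramified_le_prime_mul_natCard_strictEP`** (w2 g11 p687909 §1: `#R_rel ≤ p · #R_str`),
  **`exists_sha_ne_zero_of_level_zero_of_classGroupChiCard_ne_one_of_cmRamifiedEP`** (w2 g11 p687909 §3),
  **`pow_le_natCard_sha_of_level_zero_of_pow_le_evenChiTorsion_of_cmRamifiedEP`** (this seat, file `…LowerBoundPRankLevelZero`).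

THEOREMS ONLY; no definition, no named fact, no `sorry`. References: [MilneADT2006] I Thm. 2.8; [SerreGaloisCohomology1997] II §5.7 Thm. 5;
[Washington1997] §10.2; [SilvermanAEC2009] Thm. X.4.2.
-/

set_option autoImplicit false
-- `…BirchSwinnertonDyer.BirchSwinnertonDyer.Theorems…` is the problem's mandated namespace (D-0017).
set_option linter.dupNamespace false

noncomputable section

open scoped Classical

namespace Summit.BirchSwinnertonDyer.BirchSwinnertonDyer.Theorems.PrintCFram.SelmerCount

open NumberField IsDedekindDomain Field WeierstrassCurve
open Literature.NumberTheory.EllipticCurves Literature.NumberTheory.GaloisRepresentations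
  Literature.NumberTheory.EllipticCurves.GreenbergSelmer Literature.NumberTheory.EllipticCurves.Rank1Residual
  Literature.NumberTheory.NumberFields
open Summit.BirchSwinnertonDyer.Rank1Residual.X2.ResidualDevissageModules
open Summit.BirchSwinnertonDyer.Rank1Residual.X11b.LocBridge (localEulerPoincareCharacteristic_adicCompletionEP)
open scoped ContRepresentation

/-! ## §0 The local count `#H¹(ℚ_v, A) = p`, unconditionally -/

section LocalCount

open Literature.NumberTheory.GaloisRepresentations.DiscreteGaloisModule (mu MuCarrier)

variable {p : ℕ} [hp : Fact p.Prime] (v : HeightOneSpectrum (𝓞 ℚ))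
variable {A : Type} [AddCommGroup A] [TopologicalSpace A] [DiscreteTopology A] [Finite A]

/-- **`#H¹(ℚ_v, A) = p` UNCONDITIONALLY** for a discrete `Γ_{ℚ_v}`-module `A` of order `p` (`v ∋ p`) with `A^{Γ_v} = 0` and
`Hom_{Γ_v}(A, μ_p) = 0` — w2 g10's `natCard_galoisCohomology_one_eq_prime_of_localEuler` (p681387) with `hEP` discharged by Tate's
local Euler–Poincaré characteristic (tree theorem `localEulerPoincareCharacteristic_adicCompletionEP`).
[cite: MilneADT2006, Ch. I §2 Thm. 2.8, Cor. 2.3] [cite: SerreGaloisCohomology1997, II §5.7 Thm. 5] -/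
theorem natCard_galoisCohomology_one_eq_primeEP (hpv : ((p : ℕ) : 𝓞 ℚ) ∈ v.asIdeal)
    (ρ : DiscreteGaloisModule (v.adicCompletion ℚ) A) (hA : Nat.card A = p)
    (hinv : ∀ a : A, (∀ σ : absoluteGaloisGroup (v.adicCompletion ℚ), ρ σ a = a) → a = 0)
    (hdual : ∀ f : HomCarrier A (MuCarrier (v.adicCompletion ℚ) p),
      (∀ (σ : absoluteGaloisGroup (v.adicCompletion ℚ)) (a : A), mu (v.adicCompletion ℚ) p σ (f a) = f (ρ σ a)) → f = 0) :
    Finite (galoisCohomology ρ 1) ∧ Nat.card (galoisCohomology ρ 1) = p :=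
  natCard_galoisCohomology_one_eq_prime_of_localEuler v hpv (localEulerPoincareCharacteristic_adicCompletionEP ℚ v) ρ hA hinv hdual

end LocalCount

/-! ## §1 (LA) ⟹ CO-ALIGNED, unconditionally -/

section Coaligned

variable (W : WeierstrassCurve ℚ) [W.IsElliptic]
variable {p : ℕ} [hp : Fact p.Prime] (v : HeightOneSpectrum (𝓞 ℚ))
  (Φ : StableSubgroup (absoluteGaloisGroup ℚ) (geomTorsion W (p : ℤ)))

/-- **(LA) ⟹ CO-ALIGNED at `v`, UNCONDITIONALLY** — w2 g10's `coaligned_of_forall_exists_adaptedRoot` (p681509) with the binder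
`hEP : localEulerPoincareCharacteristic ℚ_v` discharged by the tree theorem `localEulerPoincareCharacteristic_adicCompletionEP ℚ v`
(Tate's local Euler–Poincaré characteristic, `Rank1Residual.GaloisImage.EPCTate`). Hypotheses otherwise VERBATIM: `W(ℚ_v)[p] = 0`,
`#Φ = p`, `Φ^{D_v} = 0`, a non-cyclotomic homothety in `D_v`, and (LA): every `P ∈ W(ℚ_v)` has a `Φ`-adapted `p`-th root.
[cite: MilneADT2006, Ch. I §2 Thm. 2.8, §3 Lemma 3.3] [cite: SilvermanAEC2009, X.§4 (diagram (**))] -/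
theorem coaligned_of_forall_exists_adaptedRootEP (hpv : ((p : ℕ) : 𝓞 ℚ) ∈ v.asIdeal)
    (htors : Nat.card (nsmulAddMonoidHom p :
      (W.baseChange (v.adicCompletion ℚ)).toAffine.Point →+ _).ker = 1)
    (hcard : Nat.card Φ.Sub = p)
    (hSD : ∀ s : Φ.Sub, (∀ g ∈ decomp v, g • s = s) → s = 0)
    (hSμ : ∃ g ∈ decomp v, ∃ c : ℤ, (∀ s : Φ.Sub, g • s = c • s) ∧
      ((modNCyclotomicCharacter ℚ p g : (ZMod p)ˣ) : ZMod p) ≠ (c : ZMod p))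
    (hLA : ∀ P : (W.baseChange (v.adicCompletion ℚ)).toAffine.Point,
      ∃ R : localPoints W (v.adicCompletion ℚ),
        (p : ℤ) • R = Affine.Point.map (W' := W)
          (IsScalarTower.toAlgHom ℚ (v.adicCompletion ℚ) (AlgebraicClosure (v.adicCompletion ℚ))) P ∧
        ∀ σ : absoluteGaloisGroup (v.adicCompletion ℚ), ∃ t ∈ Φ.toAddSubgroup,
          σ • R - R = pointsMap W (v.adicCompletion ℚ) (t : geomPoints W))
    (w : contOneCocycles (discreteTopRep (absoluteGaloisGroup ℚ) Φ.Sub)) :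
    oneCocycleClass (discreteTopRep (absoluteGaloisGroup ℚ) (geomTorsion W (p : ℤ)))
      (contOneCocycles.pullback (ContinuousMonoidHom.id _)
        (resHomOfEquivariant (ContinuousMonoidHom.id _) Φ.incl Φ.incl_smul) w) ∈
      selmerLocalKer W (v.adicCompletion ℚ) (p : ℤ) :=
  coaligned_of_forall_exists_adaptedRoot W v Φ hpv (localEulerPoincareCharacteristic_adicCompletionEP ℚ v) htors hcard hSD hSμ
    hLA w

end Coaligned

/-! ## §2 The (LA) branch of the census, unconditionally -/

section LA

variable (W : WeierstrassCurve ℚ) [W.IsElliptic] [W.IsGloballyMinimal]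
variable {p : ℕ} [hp : Fact p.Prime]

/-- **(LA) ⟹ `#R_rel(Φ) ≤ #Sel_p(W/ℚ)` ON THE CM-RAMIFIED CLASS, UNCONDITIONALLY** (this seat's
`natCard_h1Unramified_le_natCard_selmerGroup_of_forall_exists_adaptedRoot_of_cmRamified`, p688925, with `hEP` discharged).
[cite: MilneADT2006, Ch. I §2 Thm. 2.8] [cite: SerreGaloisCohomology1997, I.§2.6 (b) and I.§5.1] -/
theorem natCard_h1Unramified_le_natCard_selmerGroup_of_forall_exists_adaptedRoot_of_cmRamifiedEP
    (hCM : W.HasCM) (hram : CMRamified W p) (h5 : 5 ≤ p)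
    {v : HeightOneSpectrum (𝓞 ℚ)} (hpv : ((p : ℕ) : 𝓞 ℚ) ∈ v.asIdeal)
    (Φ : StableSubgroup (absoluteGaloisGroup ℚ) (geomTorsion W (p : ℤ))) (hcard : Nat.card Φ.Sub = p)
    (hLA : ∀ P : (W.baseChange (v.adicCompletion ℚ)).toAffine.Point,
      ∃ R : localPoints W (v.adicCompletion ℚ),
        (p : ℤ) • R = Affine.Point.map (W' := W)
          (IsScalarTower.toAlgHom ℚ (v.adicCompletion ℚ) (AlgebraicClosure (v.adicCompletion ℚ))) P ∧
        ∀ σ : absoluteGaloisGroup (v.adicCompletion ℚ), ∃ t ∈ Φ.toAddSubgroup,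
          σ • R - R = pointsMap W (v.adicCompletion ℚ) (t : geomPoints W)) :
    Nat.card ↥(h1Unramified Φ.Sub {v' : HeightOneSpectrum (𝓞 ℚ) | ((p : ℕ) : 𝓞 ℚ) ∈ v'.asIdeal}) ≤
      Nat.card (selmerGroup W (p : ℤ)) :=
  natCard_h1Unramified_le_natCard_selmerGroup_of_forall_exists_adaptedRoot_of_cmRamified W hCM hram h5 hpv
    (localEulerPoincareCharacteristic_adicCompletionEP ℚ v) Φ hcard hLA

/-- **CASE R ∧ EVEN-IRREGULAR ∧ (LA) ⟹ `Ш(W/ℚ)[p] ≠ 0`, UNCONDITIONALLY** — w2 g11's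
`exists_sha_ne_zero_of_forall_exists_adaptedRoot_of_classGroupChiCard_ne_one_of_cmRamified` (p685598 §3) with `hEP` discharged;
hypotheses otherwise VERBATIM (class member of rank one, `v ∋ p`, odd line `Φ` with character `θ` and (LA), reflection field `K`,
`χ̄`, `ψ̄ = ā χ̄⁻¹ ≠ 1`, `#e_{ω∘ψ̄}(ℤ_p ⊗ Cl K) ≠ 1`). [cite: Washington1997, §10.2 (Thm. 10.9)] [cite: MilneADT2006, Ch. I §2 Thm. 2.8]
[cite: SilvermanAEC2009, Thm. X.4.2] -/
theorem exists_sha_ne_zero_of_forall_exists_adaptedRoot_of_classGroupChiCard_ne_one_of_cmRamifiedEP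
    (hCM : W.HasCM) (hram : CMRamified W p) (h5 : 5 ≤ p) (hrank : W.mordellWeilRank = 1)
    {v : HeightOneSpectrum (𝓞 ℚ)} (hpv : ((p : ℕ) : 𝓞 ℚ) ∈ v.asIdeal)
    (Φ : StableSubgroup (absoluteGaloisGroup ℚ) (geomTorsion W (p : ℤ))) (hcard : Nat.card Φ.Sub = p)
    (hLA : ∀ P : (W.baseChange (v.adicCompletion ℚ)).toAffine.Point,
      ∃ R : localPoints W (v.adicCompletion ℚ),
        (p : ℤ) • R = Affine.Point.map (W' := W)
          (IsScalarTower.toAlgHom ℚ (v.adicCompletion ℚ) (AlgebraicClosure (v.adicCompletion ℚ))) P ∧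
        ∀ σ : absoluteGaloisGroup (v.adicCompletion ℚ), ∃ t ∈ Φ.toAddSubgroup,
          σ • R - R = pointsMap W (v.adicCompletion ℚ) (t : geomPoints W))
    (θ : absoluteGaloisGroup ℚ →* (ZMod p)ˣ)
    (hθ : ∀ (g : absoluteGaloisGroup ℚ) (s : Φ.Sub), g • s = (((θ g : ZMod p).val : ℕ) : ℤ) • s)
    {K : Type} [Field K] [NumberField K] [IsCMField K] [IsGalois ℚ K] (hpK : ¬ p ∣ Module.finrank ℚ K)
    (hrK : ∀ σ : absoluteGaloisGroup K, θ (absGaloisRestrict ℚ K σ) = 1)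
    {ζ : K} (hζ : IsPrimitiveRoot ζ p) (a : (K ≃ₐ[ℚ] K) → ℕ) (ha : ∀ σ₀ : K ≃ₐ[ℚ] K, σ₀ ζ = ζ ^ a σ₀)
    (χb : (K ≃ₐ[ℚ] K) →* (ZMod p)ˣ) (hχb : ∀ γ : absoluteGaloisGroup ℚ, χb (absGaloisQuot ℚ K γ) = θ γ)
    (hoddχ : χb ((IsCMField.complexConj K).restrictScalars ℚ) = -1)
    (ψb : (K ≃ₐ[ℚ] K) →* (ZMod p)ˣ) (hψb1 : ψb ≠ 1)
    (hψb : ∀ σ : K ≃ₐ[ℚ] K, ((ψb σ : (ZMod p)ˣ) : ZMod p) = (a σ : ZMod p) * (((χb σ)⁻¹ : (ZMod p)ˣ) : ZMod p))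
    (hne : classGroupChiCard ℚ K p (fun g => ((((Kato2004.teichmullerChar p).comp ψb) g : ℤ_[p]ˣ) : ℤ_[p])) ≠ 1) :
    ∃ c ∈ W.sha, c ≠ 0 ∧ p • c = 0 :=
  exists_sha_ne_zero_of_forall_exists_adaptedRoot_of_classGroupChiCard_ne_one_of_cmRamified W hCM hram h5 hrank hpv
    (localEulerPoincareCharacteristic_adicCompletionEP ℚ v) Φ hcard hLA θ hθ hpK hrK hζ a ha χb hχb hoddχ ψb hψb1 hψb hne

/-- **THE `p`-RANK LOWER BOUND, UNCONDITIONALLY** — this seat's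
`pow_succ_le_natCard_selmerGroup_of_forall_exists_adaptedRoot_of_pow_le_evenChiTorsion_of_cmRamified` (p689980) with `hEP` discharged:
CASE R member with (LA), `p^r ≤ #(e_{ω∘ψ̄}(ℤ_p ⊗ Cl K))[p]` ⟹ `p^{r+1} ≤ #Sel_p(W/ℚ)` and `p^r ≤ #(Ш(W/ℚ) ⊓ Ш[p])`.
[cite: Washington1997, §10.2 (Thm. 10.9)] [cite: Gras2003, Ch. II §5.4] [cite: MilneADT2006, Ch. I §2 Thm. 2.8] -/
theorem pow_succ_le_natCard_selmerGroup_of_forall_exists_adaptedRoot_of_pow_le_evenChiTorsion_of_cmRamifiedEP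
    (hCM : W.HasCM) (hram : CMRamified W p) (h5 : 5 ≤ p) (hrank : W.mordellWeilRank = 1)
    {v : HeightOneSpectrum (𝓞 ℚ)} (hpv : ((p : ℕ) : 𝓞 ℚ) ∈ v.asIdeal)
    (Φ : StableSubgroup (absoluteGaloisGroup ℚ) (geomTorsion W (p : ℤ))) (hcard : Nat.card Φ.Sub = p)
    (hLA : ∀ P : (W.baseChange (v.adicCompletion ℚ)).toAffine.Point,
      ∃ R : localPoints W (v.adicCompletion ℚ),
        (p : ℤ) • R = Affine.Point.map (W' := W)
          (IsScalarTower.toAlgHom ℚ (v.adicCompletion ℚ) (AlgebraicClosure (v.adicCompletion ℚ))) P ∧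
        ∀ σ : absoluteGaloisGroup (v.adicCompletion ℚ), ∃ t ∈ Φ.toAddSubgroup,
          σ • R - R = pointsMap W (v.adicCompletion ℚ) (t : geomPoints W))
    (θ : absoluteGaloisGroup ℚ →* (ZMod p)ˣ)
    (hθ : ∀ (g : absoluteGaloisGroup ℚ) (s : Φ.Sub), g • s = (((θ g : ZMod p).val : ℕ) : ℤ) • s)
    {K : Type} [Field K] [NumberField K] [IsCMField K] [IsGalois ℚ K] (hpK : ¬ p ∣ Module.finrank ℚ K)
    (hrK : ∀ σ : absoluteGaloisGroup K, θ (absGaloisRestrict ℚ K σ) = 1)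
    {ζ : K} (hζ : IsPrimitiveRoot ζ p) (a : (K ≃ₐ[ℚ] K) → ℕ) (ha : ∀ σ₀ : K ≃ₐ[ℚ] K, σ₀ ζ = ζ ^ a σ₀)
    (χb : (K ≃ₐ[ℚ] K) →* (ZMod p)ˣ) (hχb : ∀ γ : absoluteGaloisGroup ℚ, χb (absGaloisQuot ℚ K γ) = θ γ)
    (hoddχ : χb ((IsCMField.complexConj K).restrictScalars ℚ) = -1)
    (ψb : (K ≃ₐ[ℚ] K) →* (ZMod p)ˣ) (hψb1 : ψb ≠ 1)
    (hψb : ∀ σ : K ≃ₐ[ℚ] K, ((ψb σ : (ZMod p)ˣ) : ZMod p) = (a σ : ZMod p) * (((χb σ)⁻¹ : (ZMod p)ˣ) : ZMod p)) {r : ℕ}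
    (hr : p ^ r ≤ Nat.card {y : ↥(classGroupChiComponent ℚ K p
      (fun g => ((((Kato2004.teichmullerChar p).comp ψb) g : ℤ_[p]ˣ) : ℤ_[p]))) // p • y = 0}) :
    p ^ (r + 1) ≤ Nat.card (selmerGroup W (p : ℤ)) ∧
      p ^ r ≤ Nat.card (W.sha ⊓ AddSubgroup.torsionBy W.galH1 p : AddSubgroup W.galH1) :=
  pow_succ_le_natCard_selmerGroup_of_forall_exists_adaptedRoot_of_pow_le_evenChiTorsion_of_cmRamified W hCM hram h5 hrank hpv
    (localEulerPoincareCharacteristic_adicCompletionEP ℚ v) Φ hcard hLA θ hθ hpK hrK hζ a ha χb hχb hoddχ ψb hψb1 hψb hr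

end LA

/-! ## §3 The LEVEL-0 branch of the census, unconditionally -/

section LevelZeroLocal

variable (W : WeierstrassCurve ℚ) [W.IsElliptic]
variable {p : ℕ} [hp : Fact p.Prime] (v : HeightOneSpectrum (𝓞 ℚ))
  (Φ : StableSubgroup (absoluteGaloisGroup ℚ) (geomTorsion W (p : ℤ)))

omit [W.IsElliptic] in
/-- **`#R_rel(Φ) ≤ p · #R_str(Φ)` UNCONDITIONALLY** — w2 g11's `natCard_h1Unramified_le_prime_mul_natCard_strict` (p687909 §1: the
index of the STRICT classes in the RELAXED ones is at most `#H¹(ℚ_v, Φ) = p`) with `hEP` discharged; hypotheses otherwise VERBATIM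
(`#Φ = p`, `Φ^{D_v} = 0`, a non-cyclotomic homothety in `D_v`; any `S`). [cite: MilneADT2006, Ch. I §2 Thm. 2.8, Cor. 2.3]
[cite: SerreGaloisCohomology1997, I.§2.6 (b), II.§5] -/
theorem natCard_h1Unramified_le_prime_mul_natCard_strictEP (hpv : ((p : ℕ) : 𝓞 ℚ) ∈ v.asIdeal)
    (hcard : Nat.card Φ.Sub = p)
    (hSD : ∀ s : Φ.Sub, (∀ g ∈ decomp v, g • s = s) → s = 0)
    (hSμ : ∃ g ∈ decomp v, ∃ c : ℤ, (∀ s : Φ.Sub, g • s = c • s) ∧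
      ((modNCyclotomicCharacter ℚ p g : (ZMod p)ˣ) : ZMod p) ≠ (c : ZMod p))
    (S : Set (HeightOneSpectrum (𝓞 ℚ))) :
    Nat.card ↥(h1Unramified Φ.Sub S) ≤ p * Nat.card ↥(h1Unramified Φ.Sub S ⊓ subgroupResKer Φ.Sub (decomp v)) :=
  natCard_h1Unramified_le_prime_mul_natCard_strict W v Φ hpv (localEulerPoincareCharacteristic_adicCompletionEP ℚ v) hcard hSD hSμ S

end LevelZeroLocal

section LevelZero

variable (W : WeierstrassCurve ℚ) [W.IsElliptic] [W.IsGloballyMinimal]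
variable {p : ℕ} [hp : Fact p.Prime]

/-- **EVEN-IRREGULAR ∧ LEVEL `0` ⟹ `Ш(W/ℚ)[p] ≠ 0`, UNCONDITIONALLY** — w2 g11's
`exists_sha_ne_zero_of_level_zero_of_classGroupChiCard_ne_one_of_cmRamified` (p687909 §3) with `hEP` discharged; hypotheses otherwise
VERBATIM. With `stubB1Sha_of_stubB1Level_of_levelZero` (p688879) this is the unconditional reading of LEAD g13's v24 filing «B1-level |
B1-sha on level-0 members». [cite: Washington1997, §10.2 (Thm. 10.9)] [cite: MilneADT2006, Ch. I §2 Thm. 2.8] [cite: SilvermanAEC2009, Thm. X.4.2] -/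
theorem exists_sha_ne_zero_of_level_zero_of_classGroupChiCard_ne_one_of_cmRamifiedEP
    (hCM : W.HasCM) (hram : CMRamified W p) (h5 : 5 ≤ p)
    {v : HeightOneSpectrum (𝓞 ℚ)} (hpv : ((p : ℕ) : 𝓞 ℚ) ∈ v.asIdeal)
    (Φ : StableSubgroup (absoluteGaloisGroup ℚ) (geomTorsion W (p : ℤ))) (hcard : Nat.card Φ.Sub = p)
    (P : W.toAffine.Point)
    (hgen : ∀ R : W.toAffine.Point, ∃ (k : ℤ) (T : W.toAffine.Point), IsOfFinAddOrder T ∧ R = k • P + T)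
    (hlev : ∀ Q : (W.baseChange ℚ_[p]).toAffine.Point, p • Q ≠ W.toPadicPoint p P)
    (θ : absoluteGaloisGroup ℚ →* (ZMod p)ˣ)
    (hθ : ∀ (g : absoluteGaloisGroup ℚ) (s : Φ.Sub), g • s = (((θ g : ZMod p).val : ℕ) : ℤ) • s)
    {K : Type} [Field K] [NumberField K] [IsCMField K] [IsGalois ℚ K] (hpK : ¬ p ∣ Module.finrank ℚ K)
    (hrK : ∀ σ : absoluteGaloisGroup K, θ (absGaloisRestrict ℚ K σ) = 1)
    {ζ : K} (hζ : IsPrimitiveRoot ζ p) (a : (K ≃ₐ[ℚ] K) → ℕ) (ha : ∀ σ₀ : K ≃ₐ[ℚ] K, σ₀ ζ = ζ ^ a σ₀)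
    (χb : (K ≃ₐ[ℚ] K) →* (ZMod p)ˣ) (hχb : ∀ γ : absoluteGaloisGroup ℚ, χb (absGaloisQuot ℚ K γ) = θ γ)
    (hoddχ : χb ((IsCMField.complexConj K).restrictScalars ℚ) = -1)
    (ψb : (K ≃ₐ[ℚ] K) →* (ZMod p)ˣ) (hψb1 : ψb ≠ 1)
    (hψb : ∀ σ : K ≃ₐ[ℚ] K, ((ψb σ : (ZMod p)ˣ) : ZMod p) = (a σ : ZMod p) * (((χb σ)⁻¹ : (ZMod p)ˣ) : ZMod p))
    (hne : classGroupChiCard ℚ K p (fun g => ((((Kato2004.teichmullerChar p).comp ψb) g : ℤ_[p]ˣ) : ℤ_[p])) ≠ 1) :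
    ∃ c ∈ W.sha, c ≠ 0 ∧ p • c = 0 :=
  exists_sha_ne_zero_of_level_zero_of_classGroupChiCard_ne_one_of_cmRamified W hCM hram h5 hpv
    (localEulerPoincareCharacteristic_adicCompletionEP ℚ v) Φ hcard P hgen hlev θ hθ hpK hrK hζ a ha χb hχb hoddχ ψb hψb1 hψb hne

/-- **THE `p`-RANK LOWER BOUND AT LEVEL `0`, UNCONDITIONALLY** — this seat's
`pow_le_natCard_sha_of_level_zero_of_pow_le_evenChiTorsion_of_cmRamified` with `hEP` discharged: LEVEL `0` ∧
`p^r ≤ #(e_{ω∘ψ̄}(ℤ_p ⊗ Cl K))[p]` ⟹ `p^r ≤ #(Ш(W/ℚ) ⊓ Ш[p])`, no alignment / case hypothesis, no named fact.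
[cite: Washington1997, §10.2 (Thm. 10.9)] [cite: Gras2003, Ch. II §5.4] [cite: SilvermanAEC2009, Thm. X.4.2 (a)] -/
theorem pow_le_natCard_sha_of_level_zero_of_pow_le_evenChiTorsion_of_cmRamifiedEP
    (hCM : W.HasCM) (hram : CMRamified W p) (h5 : 5 ≤ p)
    {v : HeightOneSpectrum (𝓞 ℚ)} (hpv : ((p : ℕ) : 𝓞 ℚ) ∈ v.asIdeal)
    (Φ : StableSubgroup (absoluteGaloisGroup ℚ) (geomTorsion W (p : ℤ))) (hcard : Nat.card Φ.Sub = p)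
    (P : W.toAffine.Point)
    (hgen : ∀ R : W.toAffine.Point, ∃ (k : ℤ) (T : W.toAffine.Point), IsOfFinAddOrder T ∧ R = k • P + T)
    (hlev : ∀ Q : (W.baseChange ℚ_[p]).toAffine.Point, p • Q ≠ W.toPadicPoint p P)
    (θ : absoluteGaloisGroup ℚ →* (ZMod p)ˣ)
    (hθ : ∀ (g : absoluteGaloisGroup ℚ) (s : Φ.Sub), g • s = (((θ g : ZMod p).val : ℕ) : ℤ) • s)
    {K : Type} [Field K] [NumberField K] [IsCMField K] [IsGalois ℚ K] (hpK : ¬ p ∣ Module.finrank ℚ K)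
    (hrK : ∀ σ : absoluteGaloisGroup K, θ (absGaloisRestrict ℚ K σ) = 1)
    {ζ : K} (hζ : IsPrimitiveRoot ζ p) (a : (K ≃ₐ[ℚ] K) → ℕ) (ha : ∀ σ₀ : K ≃ₐ[ℚ] K, σ₀ ζ = ζ ^ a σ₀)
    (χb : (K ≃ₐ[ℚ] K) →* (ZMod p)ˣ) (hχb : ∀ γ : absoluteGaloisGroup ℚ, χb (absGaloisQuot ℚ K γ) = θ γ)
    (hoddχ : χb ((IsCMField.complexConj K).restrictScalars ℚ) = -1)
    (ψb : (K ≃ₐ[ℚ] K) →* (ZMod p)ˣ) (hψb1 : ψb ≠ 1)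
    (hψb : ∀ σ : K ≃ₐ[ℚ] K, ((ψb σ : (ZMod p)ˣ) : ZMod p) = (a σ : ZMod p) * (((χb σ)⁻¹ : (ZMod p)ˣ) : ZMod p)) {r : ℕ}
    (hr : p ^ r ≤ Nat.card {y : ↥(classGroupChiComponent ℚ K p
      (fun g => ((((Kato2004.teichmullerChar p).comp ψb) g : ℤ_[p]ˣ) : ℤ_[p]))) // p • y = 0}) :
    p ^ r ≤ Nat.card (W.sha ⊓ AddSubgroup.torsionBy W.galH1 p : AddSubgroup W.galH1) :=
  pow_le_natCard_sha_of_level_zero_of_pow_le_evenChiTorsion_of_cmRamified W hCM hram h5 hpv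
    (localEulerPoincareCharacteristic_adicCompletionEP ℚ v) Φ hcard P hgen hlev θ hθ hpK hrK hζ a ha χb hχb hoddχ ψb hψb1 hψb hr

end LevelZero

end Summit.BirchSwinnertonDyer.BirchSwinnertonDyer.Theorems.PrintCFram.SelmerCount

end
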